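import Summits.RiemannHypothesis.RiemannHypothesis.Theses.RuelleBand
import Literature.NumberTheory.LFunctions.WeilCriterionConverse
import Literature.NumberTheory.LFunctions.WeilExplicitFormulaProofs
import Summits.RiemannHypothesis.RiemannHypothesis.Theorems.RuelleBandExactFirstBandStubEvenTransfer
import HarnessLib.Audit

/-!
# Line `SketchIdeator1` (even Weil sector): real-even positivity suffices for complex-even positivity

Route `RuelleBand`, crux `Summit.RiemannHypothesis.RiemannHypothesis.Theses.RuelleBand.ExactFirstBand`
(item stmt-RiemannHypothesis-2061), line `SketchIdeator1` (Weil positivity on the EVEN REAL sector of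
test functions).  This file proves the registered stub `stub_evenComplexSector` BY NAME, with the
registered signature: Weil positivity `0 ≤ Re W(g ⋆ g̃)` for every even REAL-valued test function `g`
already gives Weil positivity for every even COMPLEX-valued test function `g`, so the line's even-sector
Weil criterion may be quoted for the complex even sector as well.

## Proof

Write an even test function `g` as `g = g₁ + i g₂` with `g₁ = Re g`, `g₂ = Im g` (pointwise,
`Complex.re_add_im`).  Both `g₁, g₂` are test functions (`C^∞` and compactly supported, being `g` composed
on the left with the real-linear maps `Re, Im : ℂ → ℝ ↪ ℂ`), both are even, and both are real-valued, so
the hypothesis gives `0 ≤ Re W(gⱼ ⋆ g̃ⱼ)` for `j = 1, 2`.  For a test function `h` the quadratic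
functional is the zero-side form, `W(h ⋆ h̃) = Q₀(h) = Σ_ρ m(ρ) P_h(ρ)` with
`P_h(ρ) = ĥ(ρ) conj ĥ(1 - ρ̄)` (`WeilConverse.zeroForm`, `WeilConverse.pairCoeff`; both sides are the
limit of the symmetric partial zero sums of `h ⋆ h̃`, by `WeilConverse.hasWeilZeroSide_zeroForm` and the
PROVED explicit formula `explicit_formula_holds`).  By linearity of the transform
(`weilMellin_add`, `weilMellin_const_mul`) `ĝ = ĝ₁ + i ĝ₂`, and for an even real `gⱼ` one has
`conj ĝⱼ(1 - ρ̄) = ĝⱼ(ρ)` (`stub_evenTransfer_conj_weilMellin`), whence TERMWISE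
`P_g(ρ) = (ĝ₁(ρ) + i ĝ₂(ρ)) (ĝ₁(ρ) - i ĝ₂(ρ)) = ĝ₁(ρ)² + ĝ₂(ρ)² = P_{g₁}(ρ) + P_{g₂}(ρ)`
(`stub_evenTransfer_pairCoeff`).  Summing over the zeros (absolute convergence,
`WeilConverse.summable_pairCoeff`), `Q₀(g) = Q₀(g₁) + Q₀(g₂)`, so
`Re W(g ⋆ g̃) = Re W(g₁ ⋆ g̃₁) + Re W(g₂ ⋆ g̃₂) ≥ 0`.

References: E. Bombieri, *Remarks on Weil's quadratic functional in the theory of prime numbers I*,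
Rend. Lincei (9) 11 (2000), 183–233, §3; A. Weil, *Sur les "formules explicites" de la théorie des
nombres premiers* (1952).
-/

-- the problem directory `RiemannHypothesis/RiemannHypothesis` fixes the namespace (gate convention)
set_option linter.dupNamespace false

noncomputable section

open Complex MeasureTheory Filter Set
open scoped Real Topology ComplexConjugate

namespace Summit.RiemannHypothesis.RiemannHypothesis.Theorems.RuelleBandExactFirstBand

open Literature.NumberTheory.LFunctions

/-- The real part `t ↦ Re g(t)` (viewed in `ℂ`) of a test function is a test function: smooth as the
composite of `g` with the real-linear map `Re : ℂ → ℝ ↪ ℂ`, compactly supported because `Re 0 = 0`.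
[folklore] -/
theorem stub_evenComplexSector_isWeilTest_re {g : ℝ → ℂ} (hg : IsWeilTest g) :
    IsWeilTest fun t : ℝ => (((g t).re : ℝ) : ℂ) :=
  ⟨(Complex.ofRealCLM.contDiff.comp Complex.reCLM.contDiff).comp hg.1,
    hg.2.comp_left (g := fun z : ℂ => (((z.re : ℝ)) : ℂ)) (by simp)⟩

/-- The imaginary part `t ↦ Im g(t)` (viewed in `ℂ`) of a test function is a test function: smooth as
the composite of `g` with the real-linear map `Im : ℂ → ℝ ↪ ℂ`, compactly supported because `Im 0 = 0`.
[folklore] -/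
theorem stub_evenComplexSector_isWeilTest_im {g : ℝ → ℂ} (hg : IsWeilTest g) :
    IsWeilTest fun t : ℝ => (((g t).im : ℝ) : ℂ) :=
  ⟨(Complex.ofRealCLM.contDiff.comp Complex.imCLM.contDiff).comp hg.1,
    hg.2.comp_left (g := fun z : ℂ => (((z.im : ℝ)) : ℂ)) (by simp)⟩

/-- Linearity of the transform on the decomposition `g = Re g + i Im g`:
`ĝ(s) = (Re g)^(s) + i (Im g)^(s)` (`weilMellin_add`, `weilMellin_const_mul`). [folklore] -/
theorem stub_evenComplexSector_weilMellin_decomp {g : ℝ → ℂ} (hg : IsWeilTest g) (s : ℂ) :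
    weilMellin g s = weilMellin (fun t : ℝ => (((g t).re : ℝ) : ℂ)) s +
      I * weilMellin (fun t : ℝ => (((g t).im : ℝ) : ℂ)) s := by
  have h1 := stub_evenComplexSector_isWeilTest_re hg
  have h2 := (stub_evenComplexSector_isWeilTest_im hg).const_mul I
  have e : g = (fun t : ℝ => (((g t).re : ℝ) : ℂ)) + fun t : ℝ => I * (((g t).im : ℝ) : ℂ) := by
    ext1 t
    simp only [Pi.add_apply]
    rw [mul_comm I]
    exact (Complex.re_add_im (g t)).symm
  conv_lhs => rw [e]
  rw [weilMellin_add h1.1.continuous h1.2 h2.1.continuous h2.2, weilMellin_const_mul]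

/-- **Termwise splitting of the zero-side coefficient.** For an even test function `g = g₁ + i g₂`
(`g₁ = Re g`, `g₂ = Im g`, both even and real): `P_g(ρ) = P_{g₁}(ρ) + P_{g₂}(ρ)`.  Indeed
`conj ĝⱼ(1 - ρ̄) = ĝⱼ(ρ)` for even real `gⱼ` (`stub_evenTransfer_conj_weilMellin`), so
`P_g(ρ) = (ĝ₁(ρ) + i ĝ₂(ρ))(ĝ₁(ρ) - i ĝ₂(ρ)) = ĝ₁(ρ)² + ĝ₂(ρ)²`, and `P_{gⱼ}(ρ) = ĝⱼ(ρ)²`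
(`stub_evenTransfer_pairCoeff`). [folklore] -/
theorem stub_evenComplexSector_pairCoeff {g : ℝ → ℂ} (hg : IsWeilTest g)
    (heven : ∀ t : ℝ, g (-t) = g t) (ρ : ℂ) :
    WeilConverse.pairCoeff g ρ =
      WeilConverse.pairCoeff (fun t : ℝ => (((g t).re : ℝ) : ℂ)) ρ +
        WeilConverse.pairCoeff (fun t : ℝ => (((g t).im : ℝ) : ℂ)) ρ := by
  have hev1 : ∀ t : ℝ, (((g (-t)).re : ℝ) : ℂ) = (((g t).re : ℝ) : ℂ) := fun t ↦ by rw [heven t]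
  have hev2 : ∀ t : ℝ, (((g (-t)).im : ℝ) : ℂ) = (((g t).im : ℝ) : ℂ) := fun t ↦ by rw [heven t]
  have hre1 : ∀ t : ℝ, ((((g t).re : ℝ) : ℂ)).im = 0 := fun t ↦ Complex.ofReal_im _
  have hre2 : ∀ t : ℝ, ((((g t).im : ℝ) : ℂ)).im = 0 := fun t ↦ Complex.ofReal_im _
  have hρ : 1 - conj (1 - conj ρ) = ρ := by simp
  rw [WeilConverse.pairCoeff, stub_evenTransfer_pairCoeff hev1 hre1,
    stub_evenTransfer_pairCoeff hev2 hre2, stub_evenComplexSector_weilMellin_decomp hg ρ,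
    stub_evenComplexSector_weilMellin_decomp hg (1 - conj ρ), map_add, map_mul,
    stub_evenTransfer_conj_weilMellin hev1 hre1, stub_evenTransfer_conj_weilMellin hev2 hre2, hρ,
    Complex.conj_I]
  linear_combination (-(weilMellin (fun t : ℝ => (((g t).im : ℝ) : ℂ)) ρ *
    weilMellin (fun t : ℝ => (((g t).im : ℝ) : ℂ)) ρ)) * Complex.I_sq

/-- **Splitting of the zero-side form.** For an even test function `g`:
`Q₀(g) = Q₀(Re g) + Q₀(Im g)` — sum the termwise identity `stub_evenComplexSector_pairCoeff` over the
non-trivial zeros (all three series converge absolutely, `WeilConverse.summable_pairCoeff`). [folklore] -/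
theorem stub_evenComplexSector_zeroForm {g : ℝ → ℂ} (hg : IsWeilTest g)
    (heven : ∀ t : ℝ, g (-t) = g t) :
    WeilConverse.zeroForm g =
      WeilConverse.zeroForm (fun t : ℝ => (((g t).re : ℝ) : ℂ)) +
        WeilConverse.zeroForm (fun t : ℝ => (((g t).im : ℝ) : ℂ)) := by
  have h1 := (WeilConverse.summable_pairCoeff (stub_evenComplexSector_isWeilTest_re hg)).hasSum
  have h2 := (WeilConverse.summable_pairCoeff (stub_evenComplexSector_isWeilTest_im hg)).hasSum
  unfold WeilConverse.zeroForm
  refine Eq.trans (tsum_congr fun ρ ↦ ?_) (h1.add h2).tsum_eq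
  rw [stub_evenComplexSector_pairCoeff hg heven]
  ring

/-- **Stub `stub_evenComplexSector` of line `SketchIdeator1` — real-even positivity suffices for
complex-even positivity (registered signature).**  If `0 ≤ Re W(g ⋆ g̃)` for every even real-valued
test function `g`, then `0 ≤ Re W(g ⋆ g̃)` for every even complex-valued test function `g`: with
`g₁ = Re g`, `g₂ = Im g` (even real test functions, `stub_evenComplexSector_isWeilTest_re/im`),
`W(g ⋆ g̃) = Q₀(g) = Q₀(g₁) + Q₀(g₂) = W(g₁ ⋆ g̃₁) + W(g₂ ⋆ g̃₂)` (`stub_evenComplexSector_zeroForm`;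
`Q₀(h) = W(h ⋆ h̃)` for a test function `h` because both are the limit of the symmetric partial zero
sums of `h ⋆ h̃`, `WeilConverse.hasWeilZeroSide_zeroForm` and the PROVED explicit formula
`explicit_formula_holds`, limits in `ℂ` being unique), and both summands have non-negative real part
by hypothesis. -/
theorem stub_evenComplexSector :
    (∀ g : ℝ → ℂ, IsWeilTest g → (∀ t : ℝ, g (-t) = g t) → (∀ t : ℝ, (g t).im = 0) →
      0 ≤ (weilQuadratic g).re) →
    ∀ g : ℝ → ℂ, IsWeilTest g → (∀ t : ℝ, g (-t) = g t) → 0 ≤ (weilQuadratic g).re := by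
  intro hB g hg heven
  have hg1 := stub_evenComplexSector_isWeilTest_re hg
  have hg2 := stub_evenComplexSector_isWeilTest_im hg
  have h1 := hB _ hg1 (fun t ↦ by simp only [heven t]) (fun t ↦ Complex.ofReal_im _)
  have h2 := hB _ hg2 (fun t ↦ by simp only [heven t]) (fun t ↦ Complex.ofReal_im _)
  -- `Q₀(h) = W(h ⋆ h̃)` for a test function `h`: both are the limit of the symmetric partial zero
  -- sums of `h ⋆ h̃` (`WeilConverse.hasWeilZeroSide_zeroForm` and the PROVED explicit formula
  -- `explicit_formula_holds`); cf. `stub_cofiniteWeilCriterion_zeroForm_eq` (crux `CofiniteCriticalLine`)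
  have hQW : ∀ {h : ℝ → ℂ}, IsWeilTest h → WeilConverse.zeroForm h = weilQuadratic h :=
    fun hh ↦ tendsto_nhds_unique (WeilConverse.hasWeilZeroSide_zeroForm hh)
      (explicit_formula_holds (hh.weilConv hh.weilReflect))
  rw [← hQW hg1] at h1
  rw [← hQW hg2] at h2
  rw [← hQW hg, stub_evenComplexSector_zeroForm hg heven, Complex.add_re]
  exact add_nonneg h1 h2

end Summit.RiemannHypothesis.RiemannHypothesis.Theorems.RuelleBandExactFirstBand

end
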